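import Summits.CriticalPhenomena.SAWScalingLimit.Theses.SAWTrackTransport
import Literature.Probability.RandomPlanarGeometry.IsometryCovariance
import HarnessLib

/-!
# Birth skeleton for the crux `AxiomsOfLimit` of route `SAWTrackTransport` (stmt-CriticalPhenomena-16965)

Crux (FIXED; rank 4 of `route-CriticalPhenomena-SAWTrackTransport`, decl
`Summit.CriticalPhenomena.SAWScalingLimit.Theses.SAWTrackTransport.AxiomsOfLimit`): every chordal family
`P` that is the ROBUST FULL LIMIT `RL(π/2) P` of the critical (`x = 1`) Glazman–Manolescu Yang–Baxter walk
on the SQUARE tiling (angle `Θ ≡ π/2`; "robust" = along every family of sub-mesh translates `D + u_δ`,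
`‖u_δ‖ ≤ δ`, and every admissible family of mid-edge endpoints), given that every Dobrushin domain admits a
square-tiling endpoint approximation, satisfies

  (i) translation covariance · (ii) similarity covariance AS SOON AS it is rotation covariant about `0` ·
  (iii) `P.IsRestrictionMarkov` · (iv) `P.IsReversible` · (v) conjugation covariance ·
  (vi) a.s. simple curves meeting `∂D` only at the two marked points.

NB. The crux directory `Cruxes/AxiomsOfLimit/` is SHARED with the homonymous but different crux
`SAWRestrictionRigidity.AxiomsOfLimit` (stmt-CriticalPhenomena-1370, uniform `δℤ²` SAW), whose registered
skeleton is `Lines/birth.lean`; the present file is the birth skeleton of stmt-16965 and lives at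
`Lines/trackTransport_birth.lean` so as not to overwrite it.

## The cut — by PROOF MECHANISM, not by conjunct (5 registered stubs + a proved composition)

The six conjuncts are of three kinds, and the line cuts along the kinds:

* EXACT LATTICE IDENTITIES + UNIQUENESS OF WEAK LIMITS. At `Θ ≡ π/2` the tiling is the unit square grid
  with corners `ℤ + (ℤ − ½) i` (`colShift ≡ sin(π/2) − i cos(π/2) = 1`), and Glazman–Manolescu's local
  weights are `D₄`-symmetric there (`u₁(π/2) = u₂(π/2)`, `w₁(π/2) = w₂(π/2)`: eq. (1) of GM19 at `θ = π/2`,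
  `sin(13π/16) = sin(3π/16)`, `sin(33π/16) = sin(π/16)`); at `x = 1` the length `|γ|` does not enter. Hence:
  - dilations `z ↦ r z`, `r > 0`: `meshFaces Θ (rΩ) δ = meshFaces Θ Ω (δ/r)` (same faces!), same weights,
    `curve Θ δ γ = r · curve Θ (δ/r) γ`, so `ybLaw(rD)_δ ∘ curve⁻¹ = (r·)_* (ybLaw(D)_{δ/r} ∘ curve⁻¹)`
    EXACTLY, and `δ/r → 0⁺ ⟺ δ → 0⁺`;
  - reversal: `γ ↦ γ^R` is a weight-preserving bijection `YBWalk Ω_δ a b ≃ YBWalk Ω_δ b a`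
    (`arcKind` is symmetric, `facesVisited`/`kindsIn` are reversal-invariant up to order inside a face)
    drawing the reversed polyline;
  - conjugation `z ↦ z̄`: face `(k, j) ↦ (k, −j)`, `vert k j ↦ vert k (−j)`, `slant k j ↦ slant k (1 − j)`,
    sides `S ↔ N` (so `corner ↔ coCorner`, harmless by the `D₄` symmetry of the weights at `π/2`),
    `meshFaces (conj Ω)` = conj of `meshFaces Ω`, polyline conjugated.
  Each identity, composed with `RL(π/2)` at the two domains (endpoint approximations exist by hypothesis,
  transported along the symmetry) and uniqueness of limits in law along `𝓝[>] 0` (`TendstoLaw.unique`,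
  `TendstoLaw.map_eq`, `Literature/Probability/Percolation/CLE6.lean`), gives the covariance of `P`.
  This is stub `stub_exactSymmetryPassage` (dilation ∧ (iv) ∧ (v)).
* LATTICE TRANSLATIONS + ROBUSTNESS. Translation by `w ∈ ℂ` is exact only for `w ∈ δ(ℤ + iℤ)`: write
  `w = δ k_δ + r_δ`, `k_δ ∈ ℤ + iℤ`, `‖r_δ‖ ≤ δ`; an endpoint approximation `(a', b')` of `D + w` translated
  by `−k_δ` is an admissible family for the SHIFTED domains `D + r_δ`, where robustness (`u := r`) makes the
  laws converge to `P D`; push forward by `· + δ k_δ → · + w` (Slutsky for the `1`-Lipschitz action of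
  translations on `CurveClass ℂ`) and compare with `RL(π/2)` at `D + w` (`u := 0`). This is the one place
  the sub-mesh translates in `RL` are used: stub `stub_translationPassage` ((i)).
* GENUINE ESTIMATES / CONSTRUCTIONS: (vi) no macroscopic self-touching and no boundary crawling of the
  critical Yang–Baxter polymer — NB the face walk may REVISIT a face (weights `w₁ = w₂`), so even the lattice
  curve is only simple as a parametrised curve through distinct mid-edges; `CurveClass.simple` is not closed,
  nothing soft gives it (stub `stub_simplePassage`, L–XL); (iii) in two steps as in the sibling skeletons
  `Lines/birth.lean` (stmt-1370) and `Cruxes/AnchorAxiomsOfLimit/Lines/split.lean`: RESTRICTION is exact at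
  the lattice level for GM's walk (empty rhombi weigh `1`, the weight of a walk is local, so conditioning the
  walk of `Ω_δ` to stay in `Ω'_δ ⊆ Ω_δ` gives the walk of `Ω'_δ`; passage = portmanteau on the closed event
  `{range ⊆ closure D'}` relative to chordal curves, null touching from (vi)) — stub `stub_restrictionPassage`
  ((vi) ⇒ `P.IsRestriction`, L); the RESTRICTION-COUPLED MARKOV KERNEL is NOT exact for the face walk (a
  revisited face couples past and future through `w/u² ≈ 0.68`), so `Q D past` must be CONSTRUCTED in the
  limit (slit-domain limits stable near the tip, or intrinsically from `P` by restriction to shrinking Jordan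
  neighbourhoods, unique by avoidance probabilities) and the revisit coupling shown irrelevant — stub
  `stub_markovPassage` (`P.IsRestriction →` (vi) `→ P.IsRestrictionMarkov`, XL, HARDEST; the crux's recorded
  why-might-fail lives here).
* PROVED HERE (no `sorry`): (ii) from (i), the dilation clause and the rotation hypothesis —
  `c z + w = (c/|c|)(|c| z) + w` (`similarity_eq_dilation_trans`) and `u z + w = 1·(u z + 0) + w`
  (`similarity_eq_rotation_trans_translation` below), covariances compose (`ChordalFamily.covariant_trans`):
  `isSimilarityCovariant_of_rotation`. So the assembly `AxiomsOfLimit_of` is not a bare conjunction: it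
  threads (vi) → restriction → Markov and DERIVES (ii).

`AxiomsOfLimit_of : stub_translationPassage → stub_exactSymmetryPassage → stub_simplePassage →
stub_restrictionPassage → stub_markovPassage → SAWTrackTransport.AxiomsOfLimit` concludes the crux BY NAME
through `axiomsOfLimit_iff` (`Iff.rfl`: the crux with its `let RL` ζ-reduced IS the statement over the
vocabulary below). No stub is the crux or the summit reworded: each delivers a proper sub-conjunction (or
a clause, dilation covariance, that the crux does not even assert unconditionally); BC3 probes
`stub → AxiomsOfLimit`, `stub → SAWScalingLimit` by `first | exact? | simpa | aesop` fail (see NOTES /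
evidence). Disproof used: none exists for this crux (`ledger crux ls stmt-CriticalPhenomena-16965`: no
`Disproof.lean`, no `Theorems/AxiomsOfLimit/Negative/`); negatives index (11 entries) respected — every
statement here is eventual in `δ` through `RL`, no `IsTightLaws` over all `δ` (refuted stmt-0772), no
locality upgrade (refuted stmt-0698).

References: A. Glazman, I. Manolescu, *Self-avoiding walk on ℤ² with Yang–Baxter weights*, AIHP 56
(2020), arXiv:1708.00395, §1 (weights (1), the model on any rhombic tiling); G. Lawler, O. Schramm,
W. Werner, *On the scaling limit of planar self-avoiding walk* (2004), arXiv:math/0204277, §3.1 (reversal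
symmetry of the weight), §3.4.5 (restriction is exact; simplicity heuristic); W. Werner, *Lectures on
two-dimensional critical percolation* (2007), §3.2 (covariance, domain Markov); T. Kennedy, G. Lawler,
*Lattice effects in the scaling limit of the two-dimensional self-avoiding walk* (2013), arXiv:1109.3091
(boundary effects); H. Duminil-Copin, A. Hammond, *Self-avoiding walk is sub-ballistic*, CMP 324 (2013).
-/

noncomputable section

open scoped Topology ENNReal NNReal
open MeasureTheory Filter Set
open Literature.Probability.RandomPlanarGeometry
open Literature.Probability.RandomPlanarGeometry.SAW.YangBaxter

namespace Summit.CriticalPhenomena.SAWScalingLimit.Cruxes.AxiomsOfLimit.TrackTransportBirth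

/-! ### Vocabulary of the line (the crux's `let` and clauses, named) -/

/-- **`RL α P` — `P` is the ROBUST FULL LIMIT of the critical Yang–Baxter walk on the rhombic tiling of
constant angle `α`** (verbatim the `let RL` of the route items): for every Dobrushin domain `D`, every
family of sub-mesh translates `D + u_δ`, `‖u_δ‖ ≤ δ`, and every family of mid-edge endpoints joined in
`(D + u_δ)_δ` whose rescaled midpoints tend to the marked points, the law `ybLaw α (D + u_δ) δ 1 a_δ b_δ`
pushed to `CurveClass ℂ` by `YBWalk.curve` converges in law to `P D` as `δ → 0⁺`.
[cite: GlazmanManolescu2019, §1] -/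
def RL (α : ℝ) (P : ChordalFamily) : Prop :=
  ∀ (D : DobrushinDomain) (u : ℝ → ℂ) (a b : ℝ → MidEdge), (∀ᶠ δ in 𝓝[>] (0 : ℝ), ‖u δ‖ ≤ δ) →
    (∀ᶠ δ in 𝓝[>] (0 : ℝ), Nonempty (YangBaxterSAW (fun (_ : ℤ) => α)
      ((D.map (similarity 1 one_ne_zero (u δ))).carrier) δ (a δ) (b δ))) →
    Tendsto (fun δ : ℝ => (δ : ℂ) * planeMidpoint (fun (_ : ℤ) => α) (a δ)) (𝓝[>] (0 : ℝ)) (𝓝 (D.pt 0)) →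
    Tendsto (fun δ : ℝ => (δ : ℂ) * planeMidpoint (fun (_ : ℤ) => α) (b δ)) (𝓝[>] (0 : ℝ)) (𝓝 (D.pt 1)) →
    TendstoLaw
      (fun δ (γ : YangBaxterSAW (fun (_ : ℤ) => α) ((D.map (similarity 1 one_ne_zero (u δ))).carrier) δ
        (a δ) (b δ)) => γ.curve (fun (_ : ℤ) => α) δ)
      (fun δ => ybLaw (fun (_ : ℤ) => α) ((D.map (similarity 1 one_ne_zero (u δ))).carrier) δ 1 (a δ) (b δ))
      id (P D)

/-- **Square-tiling endpoint approximations exist** for every Dobrushin domain (the second hypothesis of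
the crux; = conjunct (i) of `YBLimitExists` at `α = π/2`). [folklore] -/
def SqApprox : Prop :=
  ∀ D : DobrushinDomain, ∃ a b : ℝ → MidEdge, IsYBEndpointApprox (fun (_ : ℤ) => Real.pi / 2) D a b

/-- Conjunct (i): translation covariance `P (D + w) = (· + w)_* (P D)`. [cite: Werner2007, §3.2 (1)] -/
def TransCov (P : ChordalFamily) : Prop :=
  ∀ (D : DobrushinDomain) (w : ℂ),
    P (D.map (similarity 1 one_ne_zero w)) = (P D).map (CurveClass.map (similarity 1 one_ne_zero w : C(ℂ, ℂ)))

/-- The hypothesis of conjunct (ii): rotation covariance about the origin, `P (c D) = (c ·)_* (P D)`,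
`|c| = 1`. [cite: Werner2007, §3.2 (1)] -/
def RotCov (P : ChordalFamily) : Prop :=
  ∀ (D : DobrushinDomain) (c : ℂ) (hc : c ≠ 0), ‖c‖ = 1 →
    P (D.map (similarity c hc 0)) = (P D).map (CurveClass.map (similarity c hc 0 : C(ℂ, ℂ)))

/-- Dilation covariance about the origin, `P (r D) = (r ·)_* (P D)`, `r > 0` — the exact mesh-change
symmetry `(rΩ)_δ = r · Ω_{δ/r}` of a lattice scaling limit; the real content of conjunct (ii). [folklore] -/
def DilCov (P : ChordalFamily) : Prop :=
  ∀ (D : DobrushinDomain) (r : ℝ) (hr : (r : ℂ) ≠ 0), 0 < r →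
    P (D.map (similarity r hr 0)) = (P D).map (CurveClass.map (similarity r hr 0 : C(ℂ, ℂ)))

/-- Conjunct (v): conjugation covariance `P (D̄) = conj_* (P D)` (exact mirror of the square tiling in the
real axis). [folklore] -/
def ConjCov (P : ChordalFamily) : Prop :=
  ∀ D : DobrushinDomain,
    P (D.map Complex.conjLIE.toHomeomorph) =
      (P D).map (CurveClass.map (Complex.conjLIE.toHomeomorph : C(ℂ, ℂ)))

/-- Conjunct (vi): `P D` is carried by simple curve classes meeting `∂D` only at the two marked points.
[cite: LawlerSchrammWerner2004SAW, §3.4.5] -/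
def SimpleBd (P : ChordalFamily) : Prop :=
  ∀ D : DobrushinDomain, ∀ᵐ γ ∂(P D), γ ∈ CurveClass.simple ∧ γ.range ∩ frontier D.carrier ⊆ {D.pt 0, D.pt 1}

/-- **The crux, de-`let`-ed** (definitionally: `Iff.rfl`): `SAWTrackTransport.AxiomsOfLimit` is the statement
that every chordal robust full square limit is translation covariant, similarity covariant once rotation
covariant, restriction–Markov, reversible, conjugation covariant and simple. [folklore] -/
theorem axiomsOfLimit_iff :
    Summit.CriticalPhenomena.SAWScalingLimit.Theses.SAWTrackTransport.AxiomsOfLimit ↔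
      ∀ P : ChordalFamily, P.IsChordal → SqApprox → RL (Real.pi / 2) P →
        TransCov P ∧ (RotCov P → P.IsSimilarityCovariant) ∧ P.IsRestrictionMarkov ∧ P.IsReversible ∧
          ConjCov P ∧ SimpleBd P :=
  Iff.rfl

/-! ### The stubs (the ONLY `sorry`s of this file) -/

/-- **S1 `stub_translationPassage` — (i) translations pass to the robust limit** (size L). For `w ∈ ℂ`
write `w = δ k_δ + r_δ` with `k_δ ∈ ℤ + iℤ` and `‖r_δ‖ ≤ δ`. Lattice translation by `k_δ` is an exact,
weight- and mesh-preserving bijection of square-tiling walks mapping `(D + r_δ)_δ` onto `(D + w)_δ` and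
adding `δ k_δ` to the drawn curve; an endpoint approximation of `D + w` (hypothesis `SqApprox` at
`D + w`) pulled back by `−k_δ` is admissible for the shifted domains `D + r_δ`, where ROBUSTNESS (`u := r`)
gives convergence to `P D`; push forward by `· + δ k_δ → · + w` (translations act `1`-Lipschitz on
`CurveClass ℂ`, Slutsky) and compare with `RL(π/2)` at `D + w`, `u := 0`, by uniqueness of limits in law
(`TendstoLaw.unique`). Plausibly true unconditionally. [folklore] -/
theorem stub_translationPassage :
    ∀ P : ChordalFamily, P.IsChordal → SqApprox → RL (Real.pi / 2) P → TransCov P := by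
  sorry

/-- **S2 `stub_exactSymmetryPassage` — dilations, reversal and conjugation pass to the robust limit**
(size L: three lattice transport APIs for `meshFaces / YBWalk / weight / ybLaw / curve`, none yet in the
tree). Each is an EXACT identity of finite-volume laws at `Θ ≡ π/2`, `x = 1`: dilation by `r > 0` through
the mesh change `meshFaces Θ (rΩ) δ = meshFaces Θ Ω (δ/r)` and `curve Θ δ = r · curve Θ (δ/r)`; reversal
`γ ↦ γ^R` (weight-preserving, `arcKind` symmetric; polyline reversed; endpoints swapped, `MarkedDomain.swap`
/ `ChordalFamily.isReversible_of_swap`); conjugation (face `(k,j) ↦ (k,−j)`, sides `S ↔ N`, weights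
`D₄`-symmetric at `π/2`: `u₁ = u₂`, `w₁ = w₂`). Then `RL(π/2)` at both domains (approximations transported
along the symmetry) and uniqueness of limits in law (`TendstoLaw.map_eq`). Plausibly true unconditionally.
[cite: LawlerSchrammWerner2004SAW, §3.1] -/
theorem stub_exactSymmetryPassage :
    ∀ P : ChordalFamily, P.IsChordal → SqApprox → RL (Real.pi / 2) P →
      DilCov P ∧ P.IsReversible ∧ ConjCov P := by
  sorry

/-- **S3 `stub_simplePassage` — (vi) the robust limit is carried by simple curves meeting `∂D` only at the
marked points** (size L–XL; a genuine uniform estimate: no macroscopic near-self-touching — the face walk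
does revisit faces microscopically — and no boundary crawling of the critical Yang–Baxter polymer, under
every admissible endpoint family; then the open-set portmanteau and deterministic closing lemmas as in
`Cruxes/SimpleOfLimit/Lines/birth.lean`). [cite: LawlerSchrammWerner2004SAW, §3.4.5] -/
theorem stub_simplePassage :
    ∀ P : ChordalFamily, P.IsChordal → SqApprox → RL (Real.pi / 2) P → SimpleBd P := by
  sorry

/-- **S4 `stub_restrictionPassage` — restriction passes to the robust limit, given (vi)** (size L).
Lattice level EXACT for Glazman–Manolescu's walk (local weights, empty rhombi weigh `1`): the walk of
`Ω_δ` conditioned to draw all its arcs in rhombi of `Ω'_δ ⊆ Ω_δ` is the walk of `Ω'_δ`. Passage: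
portmanteau on the closed event `{range ⊆ closure D'}` relative to the chordal curves of `D̄`, whose
relative boundary ("touch `∂D' ∩ D` without crossing", "crawl on `∂D ∩ ∂D'`") is `P D`-null by
monotonicity in `D'` and by (vi); faces meeting `∂D'` need the one-rhombus boundary layer bookkeeping of
`meshFaces`. [cite: LawlerSchrammWerner2003Restriction, §1 p. 4] -/
theorem stub_restrictionPassage :
    ∀ P : ChordalFamily, P.IsChordal → SqApprox → RL (Real.pi / 2) P → SimpleBd P → P.IsRestriction := by
  sorry

/-- **S5 `stub_markovPassage` (HARDEST) — the restriction-coupled domain-Markov kernel of the robust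
limit, given restriction and (vi)** (size XL). CONSTRUCT `Q D past` with `P.IsMarkovExtension Q` (initial
clause; disintegration of `P D` at the hitting time of every closed set; dependence on the remaining slit
domain, tip and target only) and `P.IsRestrictionKernel Q`. Unlike the `δℤ²` SAW, domain-Markov is NOT
exact for the face walk (a revisited face couples past and future, weight `w/u² ≈ 0.68`), so the kernel is
built in the limit — scaling limits of the walk in SLIT domains stable under perturbation of the slit near
its tip, or intrinsically from `P` by restriction to shrinking Jordan neighbourhoods of the slit domain —
and the revisit coupling (finitely many mesoscopic pivotal faces along the past) must be shown irrelevant.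
The crux's recorded why-might-fail lives here. [cite: Werner2007, §3.2 (2)] -/
theorem stub_markovPassage :
    ∀ P : ChordalFamily, P.IsChordal → SqApprox → RL (Real.pi / 2) P → P.IsRestriction → SimpleBd P →
      P.IsRestrictionMarkov := by
  sorry

/-! ### Proved glue: rotations + translations + dilations generate all similarities -/

/-- `c z + w = 1 · (c z + 0) + w`: a rotation–translation is the rotation about `0` followed by the
translation. [folklore] -/
theorem similarity_eq_rotation_trans_translation (c : ℂ) (hc : c ≠ 0) (w : ℂ) :
    similarity c hc w = (similarity c hc 0).trans (similarity 1 one_ne_zero w) :=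
  Homeomorph.ext fun z => by
    rw [Homeomorph.trans_apply, similarity_apply, similarity_apply, similarity_apply]
    ring

/-- **(ii) from (i) + dilations + rotations** (no `sorry`): a chordal family covariant under the rotations
about `0`, under all translations and under the dilations about `0` is covariant under every similarity
`z ↦ c z + w`, `c ≠ 0` — factor `c z + w = u (|c| z) + w`, `u = c/|c|` (`similarity_eq_dilation_trans`),
`u z' + w = 1·(u z' + 0) + w`, and compose covariances (`ChordalFamily.covariant_trans`). [folklore] -/
theorem isSimilarityCovariant_of_rotation {P : ChordalFamily} (hrot : RotCov P) (htr : TransCov P)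
    (hdil : DilCov P) : P.IsSimilarityCovariant := by
  -- rotation–translations
  have hiso : ∀ (D : DobrushinDomain) (c : ℂ) (hc : c ≠ 0) (w : ℂ), ‖c‖ = 1 →
      P (D.map (similarity c hc w)) = (P D).map (CurveClass.map (similarity c hc w : C(ℂ, ℂ))) := by
    intro D c hc w h1
    rw [similarity_eq_rotation_trans_translation c hc w]
    exact ChordalFamily.covariant_trans (measurable_curveClassMap_similarity c hc 0)
      (measurable_curveClassMap_similarity 1 one_ne_zero w) (fun D => hrot D c hc h1) (fun D => htr D w) D
  -- dilation first, then a rotation–translation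
  intro D c hc w
  have hr0 : (0 : ℝ) < ‖c‖ := norm_pos_iff.2 hc
  have hr : ((‖c‖ : ℝ) : ℂ) ≠ 0 := Complex.ofReal_ne_zero.2 hr0.ne'
  have hu : c / (‖c‖ : ℂ) ≠ 0 := div_ne_zero hc hr
  have hu1 : ‖c / (‖c‖ : ℂ)‖ = 1 := by
    rw [norm_div, Complex.norm_real, Real.norm_of_nonneg hr0.le, div_self hr0.ne']
  rw [similarity_eq_dilation_trans c hc w hr hu]
  exact ChordalFamily.covariant_trans (measurable_curveClassMap_similarity _ hr 0)
    (measurable_curveClassMap_similarity _ hu w) (fun D => hdil D ‖c‖ hr hr0)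
    (fun D => hiso D _ hu w hu1) D

/-! ### Name-keyed aliases of the five stub statements (skeleton-check convention)

The skeleton audit admits a `Prop` hypothesis of the concluding theorem only if its head constant is a
registered obligation or is NAMED like a declared stub; `__Registered.stub_X` is the statement of `stub_X`
under that name (device of `Cruxes/AxiomsOfLimit/Lines/birth.lean`, `Cruxes/AnchorAxiomsOfLimit/Lines/*.lean`).
Each alias is syntactically the type of its stub. -/
namespace __Registered

/-- Alias keyed by the registered stub name. -/
abbrev stub_translationPassage : Prop :=
  ∀ P : ChordalFamily, P.IsChordal → SqApprox → RL (Real.pi / 2) P → TransCov P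
/-- Alias keyed by the registered stub name. -/
abbrev stub_exactSymmetryPassage : Prop :=
  ∀ P : ChordalFamily, P.IsChordal → SqApprox → RL (Real.pi / 2) P → DilCov P ∧ P.IsReversible ∧ ConjCov P
/-- Alias keyed by the registered stub name. -/
abbrev stub_simplePassage : Prop :=
  ∀ P : ChordalFamily, P.IsChordal → SqApprox → RL (Real.pi / 2) P → SimpleBd P
/-- Alias keyed by the registered stub name. -/
abbrev stub_restrictionPassage : Prop :=
  ∀ P : ChordalFamily, P.IsChordal → SqApprox → RL (Real.pi / 2) P → SimpleBd P → P.IsRestriction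
/-- Alias keyed by the registered stub name. -/
abbrev stub_markovPassage : Prop :=
  ∀ P : ChordalFamily, P.IsChordal → SqApprox → RL (Real.pi / 2) P → P.IsRestriction → SimpleBd P →
    P.IsRestrictionMarkov

end __Registered

/-! ### The skeleton theorem: the five stubs imply the crux, BY NAME -/

/-- **`SAWTrackTransport.AxiomsOfLimit` from the line** (kernel-checked, no `sorry` of its own): run S1
(translations), unbundle S2 (dilations, reversal, conjugation), run S3 (simplicity), feed it to S4
(restriction), feed both to S5 (restriction-coupled Markov kernel), DERIVE (ii) from S1 + dilations + the
rotation hypothesis (`isSimilarityCovariant_of_rotation`), and reassemble the six conjuncts through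
`axiomsOfLimit_iff`. Hypotheses = the five stubs under their registered names; conclusion = the route decl,
by name. [folklore] -/
theorem AxiomsOfLimit_of (h₁ : __Registered.stub_translationPassage)
    (h₂ : __Registered.stub_exactSymmetryPassage) (h₃ : __Registered.stub_simplePassage)
    (h₄ : __Registered.stub_restrictionPassage) (h₅ : __Registered.stub_markovPassage) :
    Summit.CriticalPhenomena.SAWScalingLimit.Theses.SAWTrackTransport.AxiomsOfLimit :=
  axiomsOfLimit_iff.2 fun P hch happ hRL => by
    have htr : TransCov P := h₁ P hch happ hRL
    obtain ⟨hdil, hrev, hconj⟩ := h₂ P hch happ hRL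
    have hs : SimpleBd P := h₃ P hch happ hRL
    have hr : P.IsRestriction := h₄ P hch happ hRL hs
    have hm : P.IsRestrictionMarkov := h₅ P hch happ hRL hr hs
    exact ⟨htr, fun hrot => isSimilarityCovariant_of_rotation hrot htr hdil, hm, hrev, hconj, hs⟩

/-- Wiring check (an `example`, so that `AxiomsOfLimit_of` stays the only theorem concluding the crux):
the registered stubs, with their own types, feed the skeleton theorem — this term becomes the crux proof
when the five `sorry`s above are discharged. -/
example : Summit.CriticalPhenomena.SAWScalingLimit.Theses.SAWTrackTransport.AxiomsOfLimit :=
  AxiomsOfLimit_of stub_translationPassage stub_exactSymmetryPassage stub_simplePassage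
    stub_restrictionPassage stub_markovPassage

end Summit.CriticalPhenomena.SAWScalingLimit.Cruxes.AxiomsOfLimit.TrackTransportBirth

end
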